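import Mathlib
import Literature.Computability.AlgebraicComplexity.LRPencilOfMatrix
import Summits.ValiantsHypothesis.ValiantsHypothesis.Theorems.GrenetZeonTwoDimCoefficientsDefs
import Summits.ValiantsHypothesis.ValiantsHypothesis.Theorems.GrenetZeonTwoDimCoefficientsDualUnipotentTriangular

/-!
# LEVEL FLATNESS of a block-triangular pencil: `dim K ≤ 2gn` for the directions along which the
  diagonal constituents do not move (PORTRAIT half F of the wild obstruction)

Crux `GrenetZeon.TwoDimCoefficients` (stmt-ValiantsHypothesis-8062) / rung `GrenetZeon.DualUnipotentThreeHalves`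
(stmt-ValiantsHypothesis-24318), stub `stub_dualUnipotent`.  The triangularisable rung
`sq_le_of_trace_pow_mul_strictUpper` (`…DualUnipotentTriangular`) is the case «diagonal constituents = 0» of the
following statement, proved by the SAME block-grading argument with an ARBITRARY level function.

**Theorem F1 (`finrank_le_of_diagStill`).**  Let `per_n = tr(N^d M)` with `N, M` affine `m × m` pencils, `N`
block-upper-triangular for a level function `lev : Fin m → ℕ` with `< g` levels (`N i j = 0` if `lev j < lev i`), and
let `K ≤ ℂ^{n×n}` be a space of directions along which the DIAGONAL constituents are still (the linear coefficient of
`N i j` in direction `v` vanishes whenever `lev i = lev j`, `v ∈ K`).  Then `dim K ≤ 2·g·n`.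
Proof: along `x + Σ_t s_t v_t` (`v_t ∈ K`) entry `(i, j)` of the pencil has `s`-degree `≤ lev j − lev i`
(`levGraded_aeval_line`, `levGraded_mul/pow`), so `tr(N^d M)` pulls back with degree `≤ g`
(`totalDegree_aeval_line_trace_le_lev`); all `(g+1)`-fold derivatives of `per_n` along `K` vanish
(`foldr_mkDerivation_eq_zero_of_totalDegree_le`) and LEMMA_g (`finrank_le_of_iterD_perPoly_eq_zero`) bounds `dim K`.

**Reading (the portrait inequality, citable).**  `n² ≤ 2gn + codim K`: in EVERY block form of EVERY trace-of-power /
unipotent-dual representation of `per_n`, either there are `≳ n` levels or the diagonal (wild) constituents carry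
`n² − 2gn` independent linear parameters.  With `≤ C(m/√n + 1)` levels and `m = o(n^{3/2})` the wild constituents carry
`(1 − o(1))·n²` parameters (val-idea-9 line «wild_mass», critic val-idea-crit-3 VERDICT #2 P2).

HONEST FRAMING: per-agnostic block grading + LEMMA_g; proves nothing about which block forms `per_n` admits (the
open per-specific crux `CheapParameterMass` of the line); `stub_dualUnipotent`, the 3/2 rung, the crux 8062 and
`VP ≠ VNP` are not moved.  Authored by val-idea-9 g0 (planner seat; Theorems landing by turnkey).
-/

set_option linter.dupNamespace false
set_option autoImplicit false

noncomputable section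

namespace Summit.ValiantsHypothesis.ValiantsHypothesis.Cruxes.TwoDimCoefficients.DimTwoCases

open MvPolynomial Matrix
open scoped BigOperators
open Literature.Computability.AlgebraicComplexity

section LevelFlatProof

variable {m k : ℕ}

/-- Products of level-graded matrices (degree + lev(row) ≤ lev(col) on non-zero entries) are level-graded. [folklore] -/
theorem levGraded_mul (lev : Fin m → ℕ) (Y Z : Matrix (Fin m) (Fin m) (MvPolynomial (Fin (k + 1)) ℂ))
    (hY : ∀ i j, Y i j ≠ 0 → (Y i j).totalDegree + lev i ≤ lev j)
    (hZ : ∀ i j, Z i j ≠ 0 → (Z i j).totalDegree + lev i ≤ lev j) :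
    ∀ i j, (Y * Z) i j ≠ 0 → ((Y * Z) i j).totalDegree + lev i ≤ lev j := by
  intro i j hij
  rw [Matrix.mul_apply] at hij ⊢
  obtain ⟨l, -, hl⟩ := Finset.exists_ne_zero_of_sum_ne_zero hij
  have hYl : Y i l ≠ 0 := fun h => hl (by rw [h, zero_mul])
  have hZl : Z l j ≠ 0 := fun h => hl (by rw [h, mul_zero])
  have hblock : lev i ≤ lev j :=
    ((Nat.le_add_left _ _).trans (hY i l hYl)).trans ((Nat.le_add_left _ _).trans (hZ l j hZl))
  have hterm : ∀ l', (Y i l' * Z l' j).totalDegree + lev i ≤ lev j := by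
    intro l'
    by_cases h0 : Y i l' * Z l' j = 0
    · rw [h0, totalDegree_zero, zero_add]; exact hblock
    · have h1 := hY i l' (fun h => h0 (by rw [h, zero_mul]))
      have h2 := hZ l' j (fun h => h0 (by rw [h, mul_zero]))
      have h3 := totalDegree_mul (Y i l') (Z l' j)
      omega
  have hsum := totalDegree_finsetSum Finset.univ (fun l' => Y i l' * Z l' j)
  have hsup : (Finset.univ.sup fun l' => (Y i l' * Z l' j).totalDegree) + lev i ≤ lev j := by
    have : Finset.univ.sup (fun l' => (Y i l' * Z l' j).totalDegree) ≤ lev j - lev i :=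
      Finset.sup_le fun l' _ => by have := hterm l'; omega
    omega
  omega

/-- Powers of a level-graded matrix are level-graded. [folklore] -/
theorem levGraded_pow (lev : Fin m → ℕ) (Y : Matrix (Fin m) (Fin m) (MvPolynomial (Fin (k + 1)) ℂ))
    (hY : ∀ i j, Y i j ≠ 0 → (Y i j).totalDegree + lev i ≤ lev j) (d : ℕ) :
    ∀ i j, (Y ^ d) i j ≠ 0 → ((Y ^ d) i j).totalDegree + lev i ≤ lev j := by
  induction d with
  | zero =>
      intro i j hij
      rw [pow_zero] at hij ⊢
      by_cases h : i = j
      · subst h; rw [Matrix.one_apply_eq, totalDegree_one, zero_add]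
      · exact absurd (Matrix.one_apply_ne h) hij
  | succ d ih =>
      rw [pow_succ]
      exact levGraded_mul lev _ _ ih hY

/-- Level grading of the pulled-back pencil: `N` affine and block-upper for `lev`, directions killing the same-level linear
coefficients ⇒ entry `(i, j)` of the pull-back has `s`-degree `≤ lev j − lev i`. [folklore] -/
theorem levGraded_aeval_line {n : ℕ} (lev : Fin m → ℕ) (N : AffMat n m) (hN : IsAffine N) (hup : ∀ i j : Fin m, lev j < lev i → N i j = 0)
    (x : Fin n × Fin n → ℂ) (v : Fin (k + 1) → (Fin n × Fin n → ℂ))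
    (hv : ∀ t (i j : Fin m), lev i = lev j → ∑ c, v t c * coeff (Finsupp.single c 1) (N i j) = 0) :
    ∀ i j, (N.map (aeval (fun c => (C (x c) + ∑ t, C (v t c) * X t : MvPolynomial (Fin (k + 1)) ℂ))))
        i j ≠ 0 →
      ((N.map (aeval (fun c => (C (x c) + ∑ t, C (v t c) * X t : MvPolynomial (Fin (k + 1)) ℂ))))
        i j).totalDegree + lev i ≤ lev j := by
  intro i j hij
  rw [Matrix.map_apply] at hij ⊢
  have hle : lev i ≤ lev j := by
    by_contra h
    exact hij (by rw [hup i j (not_le.mp h), map_zero])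
  by_cases heq : lev i = lev j
  · rw [aeval_line_of_totalDegree_le_one x v (hN i j)]
    simp only [hv _ i j heq, map_zero, zero_mul, Finset.sum_const_zero, add_zero, totalDegree_C,
      zero_add]
    exact hle
  · have h1 := totalDegree_aeval_line_le_one x v (hN i j)
    omega

/-- Degree of the pulled-back trace product for a `g`-level block form: `≤ g`. [folklore] -/
theorem totalDegree_aeval_line_trace_le_lev {n d g : ℕ} (lev : Fin m → ℕ) (N M : AffMat n m)
    (hN : IsAffine N) (hM : IsAffine M) (hup : ∀ i j : Fin m, lev j < lev i → N i j = 0) (hg : ∀ u : Fin m, lev u < g)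
    (x : Fin n × Fin n → ℂ) (v : Fin (g + 1) → (Fin n × Fin n → ℂ))
    (hv : ∀ t (i j : Fin m), lev i = lev j → ∑ c, v t c * coeff (Finsupp.single c 1) (N i j) = 0) :
    (aeval (fun c => (C (x c) + ∑ t, C (v t c) * X t : MvPolynomial (Fin (g + 1)) ℂ))
      ((N ^ d * M).trace)).totalDegree ≤ g := by
  set θ : Fin n × Fin n → MvPolynomial (Fin (g + 1)) ℂ := fun c => C (x c) + ∑ t, C (v t c) * X t
    with hθ
  have hmap : aeval θ ((N ^ d * M).trace) = ((N.map (aeval θ)) ^ d * M.map (aeval θ)).trace := by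
    rw [show N.map (aeval θ) = (aeval θ).toRingHom.mapMatrix N from rfl,
      show M.map (aeval θ) = (aeval θ).toRingHom.mapMatrix M from rfl, ← map_pow, ← map_mul]
    simp only [Matrix.trace, Matrix.diag_apply, map_sum, RingHom.mapMatrix_apply, Matrix.map_apply]
    rfl
  rw [hmap, Matrix.trace]
  simp only [Matrix.diag_apply, Matrix.mul_apply]
  have hgr := levGraded_pow lev (N.map (aeval θ)) (levGraded_aeval_line lev N hN hup x v hv) d
  have hbound : ∀ i j : Fin m, ((N.map (aeval θ) ^ d) i j * (M.map (aeval θ)) j i).totalDegree ≤ g := by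
    intro i j
    by_cases h0 : (N.map (aeval θ) ^ d) i j = 0
    · rw [h0, zero_mul, totalDegree_zero]; exact Nat.zero_le _
    · have h1 := hgr i j h0
      have h2 : ((M.map (aeval θ)) j i).totalDegree ≤ 1 := by
        rw [Matrix.map_apply]; exact totalDegree_aeval_line_le_one x v (hM j i)
      have h3 := totalDegree_mul ((N.map (aeval θ) ^ d) i j) ((M.map (aeval θ)) j i)
      have hj : lev j + 1 ≤ g := hg j
      omega
  refine (totalDegree_finsetSum _ _).trans (Finset.sup_le fun i _ => ?_)
  exact (totalDegree_finsetSum _ _).trans (Finset.sup_le fun j _ => hbound i j)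

end LevelFlatProof


/-- **F1 — level flatness.**  `dim K ≤ 2·g·n` for every space `K` of directions along which the diagonal constituents of
a `g`-level block-upper form of an affine trace-of-power representation of `per_n` are still. [folklore] -/
theorem finrank_le_of_diagStill {n m d g : ℕ} (N M : AffMat n m) (lev : Fin m → ℕ)
    (K : Submodule ℂ (Fin n × Fin n → ℂ)) (hN : IsAffine N) (hM : IsAffine M)
    (hup : ∀ i j : Fin m, lev j < lev i → N i j = 0) (hg : ∀ u : Fin m, lev u < g)
    (hper : perPoly (Fin n) ℂ = (N ^ d * M).trace)
    (hK : ∀ v ∈ K, ∀ i j : Fin m, lev i = lev j → ∑ c, v c * coeff (Finsupp.single c 1) (N i j) = 0) :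
    Module.finrank ℂ K ≤ 2 * g * n := by
  classical
  have hflat : ∀ dv : Fin (g + 1) → (Fin n × Fin n → ℂ), (∀ t, dv t ∈ K) →
      (List.ofFn dv).foldr
        (fun u f => mkDerivation ℂ (fun c => (C (u c) : MvPolynomial (Fin n × Fin n) ℂ)) f)
        (perPoly (Fin n) ℂ) = 0 := by
    intro dv hdv
    refine foldr_mkDerivation_eq_zero_of_totalDegree_le K _ (fun x v hv => ?_) dv hdv
    rw [hper]
    exact totalDegree_aeval_line_trace_le_lev lev N M hN hM hup hg x v
      (fun t i j hij => hK (v t) (hv t) i j hij)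
  have h := finrank_le_of_iterD_perPoly_eq_zero K hflat
  calc Module.finrank ℂ K ≤ g * (2 * n) := h
    _ = 2 * g * n := by ring

/-- Sanity / calibration: for a STRICTLY upper triangular pencil with `lev = id` every direction keeps the (zero)
diagonal constituents still, so `finrank_le_of_diagStill` with `K` = «directions killing the within-block linear
coefficients» is the triangularisable rung's dimension count. -/
theorem diagStill_of_strictUpper {n m : ℕ} (N : AffMat n m) (htri : ∀ i j : Fin m, j ≤ i → N i j = 0)
    (v : Fin n × Fin n → ℂ) (i j : Fin m) (h : (i : ℕ) = (j : ℕ)) :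
    ∑ c, v c * coeff (Finsupp.single c 1) (N i j) = 0 := by
  have hij : i = j := Fin.ext h
  subst hij
  simp [htri i i le_rfl]

end Summit.ValiantsHypothesis.ValiantsHypothesis.Cruxes.TwoDimCoefficients.DimTwoCases

end
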